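import Mathlib
import HarnessLib
import Summits.AtomisticToContinuum.Crystallization.Theorems.PricedLinkCensusSoftFourRingsLinkStar

/-!
# Soft four-rings: from the twelve-point reduction to the hull setting

Support file for `SoftFourRings` (route `PricedLinkCensus`, sub-problem `Crystallization`).

`hull_setting_of_twelve` : under the hypotheses of `softFourRings_of_twelve_unit` (twelve points
`z j`, `1 ≤ ‖z j‖ ≤ (1 + η) min 1 (n j)`, `n j ≤ ‖z j‖`, `n j ≤ dist (z j) (z k)`, exactly four
bonds at every point, `0 < η ≤ 1/100`) the set `X` of the twelve directions and the family `B`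
of bonded pairs of directions satisfy the hypotheses of the hull-level theory
(`PricedLinkCensusSoftFourRingsGlobal`, `…NoSlack`): unit vectors, `#X = 12`, pairwise cosine
`≤ 1 − 1/(2·1.01²)`, bonds at cosine `≥ 1 − 1.01²/2`, `#B = 24`, four bonds at every point,
non-bonded pairs at cosine `< 1.01/2`, and every direction is within `η` of its point.
-/

namespace Summit.AtomisticToContinuum.Crystallization.Theorems

open Real RealInnerProductSpace

/-- Equality of two-element `Finset`s. -/
theorem finset_pair_eq_pair_iff {α : Type*} [DecidableEq α] {a b c d : α} :
    ({a, b} : Finset α) = {c, d} ↔ (a = c ∧ b = d) ∨ (a = d ∧ b = c) := by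
  rw [← Finset.coe_inj, Finset.coe_pair, Finset.coe_pair, Set.pair_eq_pair_iff]

/-- **Non-bonded pairs are not too close**: if `dist (z j) (z k) > (1 + η) min (n j) (n k)` then
`⟪z j, z k⟫ < (1 + η)/2 · ‖z j‖ ‖z k‖`. -/
theorem inner_lt_of_nonbond {η : ℝ} (hη : 0 ≤ η)
    {z : Fin 12 → EuclideanSpace ℝ (Fin 3)} {n : Fin 12 → ℝ}
    (h1 : ∀ j, 1 ≤ ‖z j‖) (h2 : ∀ j, ‖z j‖ ≤ (1 + η) * min 1 (n j)) {j k : Fin 12}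
    (hnb : (1 + η) * min (n j) (n k) < dist (z j) (z k)) :
    inner ℝ (z j) (z k) < (1 + η) / 2 * (‖z j‖ * ‖z k‖) := by
  have hm0 : (0 : ℝ) < 1 + η := by linarith
  have hd : dist (z j) (z k) ^ 2 = ‖z j‖ ^ 2 - 2 * inner ℝ (z j) (z k) + ‖z k‖ ^ 2 := by
    rw [dist_eq_norm, norm_sub_sq_real]
  have hnj : ‖z j‖ ≤ (1 + η) * n j :=
    (h2 j).trans (mul_le_mul_of_nonneg_left (min_le_right _ _) hm0.le)
  have hnk : ‖z k‖ ≤ (1 + η) * n k :=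
    (h2 k).trans (mul_le_mul_of_nonneg_left (min_le_right _ _) hm0.le)
  have hj1 : ‖z j‖ ≤ 1 + η := (h2 j).trans (by
    have := min_le_left (1 : ℝ) (n j); nlinarith)
  have hk1 : ‖z k‖ ≤ 1 + η := (h2 k).trans (by
    have := min_le_left (1 : ℝ) (n k); nlinarith)
  rcases le_total ‖z j‖ ‖z k‖ with hle | hle
  · -- `dist > ‖z j‖`
    have hdj : ‖z j‖ < dist (z j) (z k) := by
      refine lt_of_le_of_lt ?_ hnb
      rw [mul_min_of_nonneg _ _ hm0.le]
      exact le_min hnj (hle.trans hnk)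
    have hd2 : ‖z j‖ ^ 2 < dist (z j) (z k) ^ 2 := by
      exact pow_lt_pow_left₀ hdj (norm_nonneg _) two_ne_zero
    have hkk : ‖z k‖ * ‖z k‖ ≤ (1 + η) * (‖z j‖ * ‖z k‖) := by
      have : ‖z k‖ ≤ (1 + η) * ‖z j‖ := hk1.trans (by nlinarith [h1 j])
      nlinarith [norm_nonneg (z k)]
    nlinarith
  · have hdk : ‖z k‖ < dist (z j) (z k) := by
      refine lt_of_le_of_lt ?_ hnb
      rw [mul_min_of_nonneg _ _ hm0.le]
      exact le_min (hle.trans hnj) hnk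
    have hd2 : ‖z k‖ ^ 2 < dist (z j) (z k) ^ 2 := by
      exact pow_lt_pow_left₀ hdk (norm_nonneg _) two_ne_zero
    have hjj : ‖z j‖ * ‖z j‖ ≤ (1 + η) * (‖z j‖ * ‖z k‖) := by
      have : ‖z j‖ ≤ (1 + η) * ‖z k‖ := hj1.trans (by nlinarith [h1 k])
      nlinarith [norm_nonneg (z j)]
    nlinarith

/-- **The hull setting of the twelve-point reduction.**  See the module docstring. -/
theorem hull_setting_of_twelve {η : ℝ} (hη : 0 < η) (hη1 : η ≤ 1 / 100)
    {z : Fin 12 → EuclideanSpace ℝ (Fin 3)} {n : Fin 12 → ℝ}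
    (h1 : ∀ j, 1 ≤ ‖z j‖) (h2 : ∀ j, ‖z j‖ ≤ (1 + η) * min 1 (n j)) (h3 : ∀ j, n j ≤ ‖z j‖)
    (h4 : ∀ j k, j ≠ k → n j ≤ dist (z j) (z k))
    (h5 : ∀ j, (Finset.univ.filter (fun k : Fin 12 =>
      k ≠ j ∧ dist (z j) (z k) ≤ (1 + η) * min (n j) (n k))).card = 4) :
    ∃ (X : Finset (EuclideanSpace ℝ (Fin 3))) (B : Finset (Finset (EuclideanSpace ℝ (Fin 3)))),
      (∀ y ∈ X, ‖y‖ = 1) ∧ X.card = 12 ∧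
      (∀ u ∈ X, ∀ u' ∈ X, u ≠ u' → ⟪u, u'⟫ ≤ 1 - 1 / (2 * (101 / 100 : ℝ) ^ 2)) ∧
      (∀ T ∈ B, ∃ u ∈ X, ∃ u' ∈ X, u ≠ u' ∧ 1 - (101 / 100 : ℝ) ^ 2 / 2 ≤ ⟪u, u'⟫ ∧
        T = {u, u'}) ∧
      B.card = 24 ∧
      (∀ v ∈ X, ∃ w : Fin 4 → EuclideanSpace ℝ (Fin 3), (∀ k, w k ∈ X) ∧
        Function.Injective w ∧ (∀ k, w k ≠ v) ∧
        (∀ k, ({v, w k} : Finset (EuclideanSpace ℝ (Fin 3))) ∈ B) ∧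
        ∀ y, ({v, y} : Finset (EuclideanSpace ℝ (Fin 3))) ∈ B → ∃ k, y = w k) ∧
      (∀ u ∈ X, ∀ u' ∈ X, u ≠ u' → ({u, u'} : Finset (EuclideanSpace ℝ (Fin 3))) ∉ B →
        ⟪u, u'⟫ < 101 / 200) ∧
      (∀ x ∈ X, ∃ j, dist (z j) x ≤ η) := by
  classical
  have hη0 : 0 ≤ η := hη.le
  have hpos : ∀ j, 0 < ‖z j‖ := fun j => lt_of_lt_of_le one_pos (h1 j)
  -- the directions (as in `link_unit_window`, but we need them explicitly)
  set u : Fin 12 → EuclideanSpace ℝ (Fin 3) := fun j => (‖z j‖)⁻¹ • z j with hu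
  have hun : ∀ j, ‖u j‖ = 1 := fun j => by
    rw [hu, norm_smul, norm_inv, norm_norm, inv_mul_cancel₀ (hpos j).ne']
  have hinner : ∀ a b, ⟪u a, u b⟫ = ⟪z a, z b⟫ / (‖z a‖ * ‖z b‖) := by
    intro a b
    rw [hu, real_inner_smul_left, real_inner_smul_right, div_eq_inv_mul, mul_inv]
    ring
  have hmulpos : ∀ a b, 0 < ‖z a‖ * ‖z b‖ := fun a b => mul_pos (hpos a) (hpos b)
  have hca : 1 - 1 / (2 * (1 + η) ^ 2) ≤ 1 - 1 / (2 * (101 / 100 : ℝ) ^ 2) := by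
    have : (1 + η) ^ 2 ≤ (101 / 100 : ℝ) ^ 2 := by nlinarith
    have h2' : 1 / (2 * (101 / 100 : ℝ) ^ 2) ≤ 1 / (2 * (1 + η) ^ 2) :=
      one_div_le_one_div_of_le (by positivity) (by linarith)
    linarith
  have hcb : 1 - (101 / 100 : ℝ) ^ 2 / 2 ≤ 1 - (1 + η) ^ 2 / 2 := by nlinarith
  have husep : ∀ a b, a ≠ b → ⟪u a, u b⟫ ≤ 1 - 1 / (2 * (101 / 100 : ℝ) ^ 2) := by
    intro a b hab
    rw [hinner, div_le_iff₀ (hmulpos a b)]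
    exact (inner_le_of_link hη0 (by linarith) h1 h2 h4 hab).trans
      (mul_le_mul_of_nonneg_right hca (hmulpos a b).le)
  have hubond : ∀ a b, dist (z a) (z b) ≤ (1 + η) * min (n a) (n b) →
      1 - (101 / 100 : ℝ) ^ 2 / 2 ≤ ⟪u a, u b⟫ := by
    intro a b hb
    rw [hinner, le_div_iff₀ (hmulpos a b)]
    exact (mul_le_mul_of_nonneg_right hcb (hmulpos a b).le).trans (le_inner_of_bond hη0 h3 hb)
  have hunb : ∀ a b, (1 + η) * min (n a) (n b) < dist (z a) (z b) → ⟪u a, u b⟫ < 101 / 200 := by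
    intro a b hnb
    rw [hinner, div_lt_iff₀ (hmulpos a b)]
    refine (inner_lt_of_nonbond hη0 h1 h2 hnb).trans_le ?_
    exact mul_le_mul_of_nonneg_right (by linarith) (hmulpos a b).le
  -- injectivity
  have huinj : Function.Injective u := by
    intro a b hab
    by_contra hne
    have h := husep a b hne
    rw [hab, real_inner_self_eq_norm_sq, hun] at h
    norm_num at h
  -- the bond relation on indices
  set R : Fin 12 → Fin 12 → Prop := fun a b => a ≠ b ∧ dist (z a) (z b) ≤ (1 + η) * min (n a) (n b)
    with hR
  have hRsymm : ∀ a b, R a b → R b a := by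
    rintro a b ⟨hne, hd⟩
    exact ⟨hne.symm, by rwa [dist_comm, min_comm]⟩
  -- the sets
  set X : Finset (EuclideanSpace ℝ (Fin 3)) := Finset.univ.image u with hX
  set U : Finset (Fin 12 × Fin 12) := Finset.univ.filter (fun ab => ab.1 < ab.2 ∧ R ab.1 ab.2)
    with hU
  set B : Finset (Finset (EuclideanSpace ℝ (Fin 3))) :=
    U.image (fun ab => ({u ab.1, u ab.2} : Finset (EuclideanSpace ℝ (Fin 3)))) with hB
  have hmemX : ∀ j, u j ∈ X := fun j => Finset.mem_image.2 ⟨j, Finset.mem_univ _, rfl⟩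
  have hXe : ∀ x ∈ X, ∃ j, x = u j := fun x hx => by
    obtain ⟨j, -, rfl⟩ := Finset.mem_image.1 hx; exact ⟨j, rfl⟩
  -- membership in `B`
  have hmemB : ∀ a b, R a b → ({u a, u b} : Finset (EuclideanSpace ℝ (Fin 3))) ∈ B := by
    intro a b hab
    rcases lt_or_gt_of_ne hab.1 with h | h
    · exact Finset.mem_image.2 ⟨(a, b), Finset.mem_filter.2 ⟨Finset.mem_univ _, h, hab⟩, rfl⟩
    · rw [Finset.pair_comm]
      exact Finset.mem_image.2 ⟨(b, a), Finset.mem_filter.2 ⟨Finset.mem_univ _, h, hRsymm a b hab⟩,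
        rfl⟩
  have hBmem : ∀ T ∈ B, ∃ a b, a < b ∧ R a b ∧ T = {u a, u b} := by
    intro T hT
    obtain ⟨⟨a, b⟩, hab, rfl⟩ := Finset.mem_image.1 hT
    obtain ⟨-, hlt, hRab⟩ := Finset.mem_filter.1 hab
    exact ⟨a, b, hlt, hRab, rfl⟩
  have hpairB : ∀ a y, ({u a, y} : Finset (EuclideanSpace ℝ (Fin 3))) ∈ B → ∃ b, R a b ∧ y = u b := by
    intro a y h
    obtain ⟨c, d, -, hRcd, he⟩ := hBmem _ h
    rcases finset_pair_eq_pair_iff.1 he with ⟨hac, rfl⟩ | ⟨had, rfl⟩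
    · exact ⟨d, (huinj hac) ▸ hRcd, rfl⟩
    · exact ⟨c, (huinj had) ▸ hRsymm c d hRcd, rfl⟩
  refine ⟨X, B, ?_, ?_, ?_, ?_, ?_, ?_, ?_, ?_⟩
  · intro y hy
    obtain ⟨j, rfl⟩ := hXe y hy
    exact hun j
  · rw [hX, Finset.card_image_of_injective _ huinj, Finset.card_univ, Fintype.card_fin]
  · intro x hx x' hx' hne
    obtain ⟨a, rfl⟩ := hXe x hx
    obtain ⟨b, rfl⟩ := hXe x' hx'
    exact husep a b fun h => hne (h ▸ rfl)
  · intro T hT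
    obtain ⟨a, b, -, hRab, rfl⟩ := hBmem T hT
    exact ⟨u a, hmemX a, u b, hmemX b, fun h => hRab.1 (huinj h), hubond a b hRab.2, rfl⟩
  · -- `#B = 24`: `B ≃ U`, `2 #U = #O = Σ_a 4 = 48`
    have hinjU : Set.InjOn (fun ab : Fin 12 × Fin 12 =>
        ({u ab.1, u ab.2} : Finset (EuclideanSpace ℝ (Fin 3)))) U := by
      rintro ⟨a, b⟩ hab ⟨c, d⟩ hcd he
      obtain ⟨-, hlt, -⟩ := Finset.mem_filter.1 (Finset.mem_coe.1 hab)
      obtain ⟨-, hlt', -⟩ := Finset.mem_filter.1 (Finset.mem_coe.1 hcd)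
      rcases finset_pair_eq_pair_iff.1 he with ⟨hac, hbd⟩ | ⟨had, hbc⟩
      · exact Prod.ext (huinj hac) (huinj hbd)
      · exfalso
        have ha := huinj had
        have hb := huinj hbc
        simp only at ha hb hlt hlt'
        rw [ha, hb] at hlt
        exact lt_asymm hlt hlt'
    rw [hB, Finset.card_image_of_injOn hinjU]
    -- ordered pairs
    set O : Finset (Fin 12 × Fin 12) := Finset.univ.filter (fun ab => R ab.1 ab.2) with hO
    have hOcard : O.card = 48 := by
      rw [Finset.card_eq_sum_card_fiberwise (f := Prod.fst) (s := O) (t := Finset.univ)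
        (fun _ _ => Finset.mem_univ _)]
      have hfib : ∀ a : Fin 12, (O.filter (fun ab => ab.1 = a)).card = 4 := by
        intro a
        rw [← h5 a]
        refine Finset.card_bij (fun ab _ => ab.2) ?_ ?_ ?_
        · rintro ⟨a', b⟩ hab
          rw [Finset.mem_filter] at hab
          obtain ⟨hO', rfl⟩ := hab
          obtain ⟨-, hR'⟩ := Finset.mem_filter.1 hO'
          exact Finset.mem_filter.2 ⟨Finset.mem_univ _, hR'.1.symm, hR'.2⟩
        · rintro ⟨a₁, b₁⟩ h₁ ⟨a₂, b₂⟩ h₂ (he : b₁ = b₂)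
          rw [Finset.mem_filter] at h₁ h₂
          obtain ⟨-, rfl⟩ := h₁
          obtain ⟨-, rfl⟩ := h₂
          rw [he]
        · intro b hb
          obtain ⟨-, hne, hd⟩ := Finset.mem_filter.1 hb
          exact ⟨(a, b), Finset.mem_filter.2 ⟨Finset.mem_filter.2 ⟨Finset.mem_univ _, hne.symm, hd⟩,
            rfl⟩, rfl⟩
      rw [Finset.sum_congr rfl (fun a _ => hfib a)]
      simp
    -- `O` splits into `U` and its mirror image
    have hsplit := Finset.card_filter_add_card_filter_not (s := O) (fun ab => ab.1 < ab.2)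
    have hU' : O.filter (fun ab => ab.1 < ab.2) = U := by
      ext ⟨a, b⟩
      simp only [hO, hU, Finset.mem_filter, Finset.mem_univ, true_and]
      tauto
    have hmirror : (O.filter (fun ab => ¬ ab.1 < ab.2)).card = U.card := by
      refine Finset.card_bij (fun ab _ => (ab.2, ab.1)) ?_ ?_ ?_
      · rintro ⟨a, b⟩ hab
        rw [Finset.mem_filter] at hab
        obtain ⟨hO', hnlt⟩ := hab
        obtain ⟨-, hR'⟩ := Finset.mem_filter.1 hO'
        refine Finset.mem_filter.2 ⟨Finset.mem_univ _, ?_, hRsymm a b hR'⟩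
        exact lt_of_le_of_ne (not_lt.1 hnlt) (fun h => hR'.1 h.symm)
      · rintro ⟨a₁, b₁⟩ - ⟨a₂, b₂⟩ - he
        simp only [Prod.mk.injEq] at he
        rw [he.1, he.2]
      · rintro ⟨a, b⟩ hab
        obtain ⟨-, hlt, hR'⟩ := Finset.mem_filter.1 hab
        exact ⟨(b, a), Finset.mem_filter.2 ⟨Finset.mem_filter.2 ⟨Finset.mem_univ _, hRsymm a b hR'⟩,
          not_lt.2 hlt.le⟩, rfl⟩
    rw [hU', hmirror, hOcard] at hsplit
    omega
  · -- four bonds at every point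
    intro v hv
    obtain ⟨a, rfl⟩ := hXe v hv
    set S := Finset.univ.filter (fun k : Fin 12 => k ≠ a ∧ dist (z a) (z k) ≤ (1 + η) * min (n a) (n k))
      with hS
    have e : {k // k ∈ S} ≃ Fin 4 := Fintype.equivFinOfCardEq (by rw [Fintype.card_coe]; exact h5 a)
    have hSR : ∀ k : {k // k ∈ S}, R a k.1 := fun k => by
      obtain ⟨-, hne, hd⟩ := Finset.mem_filter.1 k.2
      exact ⟨hne.symm, hd⟩
    refine ⟨fun k => u (e.symm k).1, fun k => hmemX _, ?_, ?_, ?_, ?_⟩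
    · intro k k' h
      exact e.symm.injective (Subtype.ext (huinj h))
    · intro k h
      exact (hSR (e.symm k)).1 (huinj h).symm
    · intro k
      exact hmemB a _ (hSR (e.symm k))
    · intro y hy
      obtain ⟨b, hRab, rfl⟩ := hpairB a y hy
      refine ⟨e ⟨b, Finset.mem_filter.2 ⟨Finset.mem_univ _, hRab.1.symm, hRab.2⟩⟩, ?_⟩
      simp only [Equiv.symm_apply_apply]
  · -- non-bonded pairs
    intro x hx x' hx' hne hnB
    obtain ⟨a, rfl⟩ := hXe x hx
    obtain ⟨b, rfl⟩ := hXe x' hx'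
    have hab : a ≠ b := fun h => hne (h ▸ rfl)
    refine hunb a b (lt_of_not_ge fun hle => hnB (hmemB a b ⟨hab, hle⟩))
  · -- every direction is within `η` of its point
    intro x hx
    obtain ⟨j, rfl⟩ := hXe x hx
    refine ⟨j, ?_⟩
    have hz : z j = ‖z j‖ • u j := by
      rw [hu, smul_smul, mul_inv_cancel₀ (hpos j).ne', one_smul]
    have hr1 : ‖z j‖ ≤ 1 + η := (h2 j).trans (by
      have := min_le_left (1 : ℝ) (n j); nlinarith)
    calc dist (z j) (u j) = ‖(‖z j‖ - 1) • u j‖ := by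
          rw [dist_eq_norm, sub_smul, one_smul, ← hz]
      _ = ‖z j‖ - 1 := by
          rw [norm_smul, hun, mul_one, Real.norm_eq_abs, abs_of_nonneg (by linarith [h1 j])]
      _ ≤ η := by linarith

end Summit.AtomisticToContinuum.Crystallization.Theorems
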